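import Mathlib.Analysis.InnerProductSpace.Basic
import Mathlib.Analysis.InnerProductSpace.Continuous
import Mathlib.LinearAlgebra.Matrix.NonsingularInverse
import Mathlib.Topology.Instances.Matrix
import Mathlib.LinearAlgebra.FiniteDimensional.Lemmas
import HarnessLib

/-!
# The stable normal frame of a stabilised immersion: pointwise linear algebra

Kervaire–Milnor, *Groups of homotopy spheres I*, Ann. of Math. 77 (1963), proof of Thm. 3.1
(p. 508: "`τ ⊕ ν` is trivial … `ν` is stably trivial") and Milnor–Stasheff, *Characteristic
classes* (1974), §2 Lemma 2.? / §3: if the tangent bundle of `W` is stably trivial,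
`τ ⊕ ε ≅ ε^{d+1}`, then the normal bundle of `W ↪ V` becomes trivial after adding `d + 1` trivial
summands, i.e. the normal bundle of the STABILISED embedding `W ↪ V × ℝ^{d+1}`, `w ↦ (E w, 0)`, is
trivial — with an EXPLICIT frame. This file is the pointwise linear algebra of that frame, for a
real inner product space `V` and a finite family `σⱼ = (tⱼ, rⱼ) ∈ V × ℝ` (the push-forward of the
stable tangent frame: `tⱼ = dE(uⱼ)`, `rⱼ` the `ℝ`-components), written so that every quantity is
a CONTINUOUS, chart-free function of the data `(t, r)`:

* `gram t r` — the Gram matrix of `σ` for the form `⟪v, v'⟫ + ρρ'`; `pairVec`, `projCoord t r b ρ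
  = (gram t r)⁻¹ (⟪tₖ, b⟫ + rₖ ρ)ₖ` — the `σ`-coordinates of the orthogonal projection of `(b, ρ)`
  onto `S = span σ`;
* **`normalVec t r b μ = (b − ∑ⱼ projCoord(b,0)ⱼ tⱼ, projCoord(b,0) + μ • projCoord(0,1))`** — the
  normal frame map `V × ℝ → V × ℝ^κ`;
* `projCoord_combo` (coordinates of an element of `S`), `pairVec_residual` (the residual is
  orthogonal to `S`), `sum_projCoord_mul_r` (the `ℝ`-component of the projection of `(b, 0)`
  vanishes when `(0,1) ∈ S`), `proj_eq_self_of_mem_span` (the `V`-projection fixes `span t`);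
* **`normalVec_transverse`** — if `(0,1) ∈ S` then `(u, 0) = normalVec t r b μ` with `u ∈ span t`
  forces `u = 0, b = 0, μ = 0`: the frame is transverse to `span t × 0` and injective;
* **`normalVec_spanning`** — every `(v, c) ∈ V × ℝ^κ` is `(u, 0) + normalVec t r b μ` with
  `u ∈ span t`;
* `continuous_normalVec` — continuity in the data where `det (gram t r) ≠ 0`.

Pure linear algebra; everything is proved, no named facts.

## References

* M. Kervaire, J. Milnor, *Groups of homotopy spheres I*, Ann. of Math. 77 (1963), §3, proof of
  Thm. 3.1 p. 508. [KervaireMilnorAnnals1963]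
* J. Milnor, J. Stasheff, *Characteristic classes*, Princeton UP 1974, §3 (Whitney sums, stable
  triviality). [MilnorStasheff1974]
-/

noncomputable section

open Matrix Finset
open scoped RealInnerProductSpace

namespace Literature.Topology.FourManifolds

namespace StableNormalFrame

variable {V : Type*} [NormedAddCommGroup V] [InnerProductSpace ℝ V]
variable {κ : Type*} [Fintype κ] [DecidableEq κ]

/-! ### The Gram matrix and the projection coordinates -/

/-- The Gram matrix of the family `σⱼ = (tⱼ, rⱼ) ∈ V × ℝ` for the positive definite form
`⟪v, v'⟫ + ρρ'`. [cite: KervaireMilnorAnnals1963, §3 proof of Thm. 3.1] -/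
def gram (t : κ → V) (r : κ → ℝ) : Matrix κ κ ℝ :=
  Matrix.of fun j k => ⟪t j, t k⟫ + r j * r k

/-- The pairings of `(b, ρ) ∈ V × ℝ` with the family: `k ↦ ⟪tₖ, b⟫ + rₖ ρ`. [folklore] -/
def pairVec (t : κ → V) (r : κ → ℝ) (b : V) (ρ : ℝ) : κ → ℝ :=
  fun k => ⟪t k, b⟫ + r k * ρ

/-- The `σ`-coordinates of the orthogonal projection of `(b, ρ)` onto `span σ`:
`(gram t r)⁻¹ (pairVec t r b ρ)`. [folklore] -/
def projCoord (t : κ → V) (r : κ → ℝ) (b : V) (ρ : ℝ) : κ → ℝ :=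
  (gram t r)⁻¹ *ᵥ pairVec t r b ρ

/-- **The normal frame map** of the stabilised immersion (Kervaire–Milnor 1963, proof of Thm. 3.1;
Milnor–Stasheff §3): `(b, μ) ↦ (b − π b, Ψ(π b, 0) + μ Ψ(0, 1))` where `π` is the orthogonal
projection onto `span t` and `Ψ` the `σ`-coordinates. [cite: KervaireMilnorAnnals1963, §3 proof of Thm. 3.1] -/
def normalVec (t : κ → V) (r : κ → ℝ) (b : V) (μ : ℝ) : V × (κ → ℝ) :=
  (b - ∑ j, projCoord t r b 0 j • t j, projCoord t r b 0 + μ • projCoord t r 0 1)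

omit [Fintype κ] [DecidableEq κ] in
/-- `pairVec` is additive in `(b, ρ)`. [folklore] -/
lemma pairVec_add (t : κ → V) (r : κ → ℝ) (b b' : V) (ρ ρ' : ℝ) :
    pairVec t r (b + b') (ρ + ρ') = pairVec t r b ρ + pairVec t r b' ρ' := by
  funext k; simp only [pairVec, inner_add_right, Pi.add_apply]; ring

omit [Fintype κ] [DecidableEq κ] in
/-- `pairVec` is homogeneous in `(b, ρ)`. [folklore] -/
lemma pairVec_smul (t : κ → V) (r : κ → ℝ) (c : ℝ) (b : V) (ρ : ℝ) :
    pairVec t r (c • b) (c * ρ) = c • pairVec t r b ρ := by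
  funext k; simp only [pairVec, inner_smul_right, Pi.smul_apply, smul_eq_mul]; ring

omit [DecidableEq κ] in
/-- **The Gram matrix is the pairing of combinations**: `gram t r *ᵥ α = pairVec (∑ αⱼ tⱼ) (∑ αⱼ rⱼ)`.
[folklore] -/
lemma gram_mulVec (t : κ → V) (r : κ → ℝ) (α : κ → ℝ) :
    gram t r *ᵥ α = pairVec t r (∑ j, α j • t j) (∑ j, α j * r j) := by
  funext k
  simp only [gram, pairVec, Matrix.mulVec, dotProduct, Matrix.of_apply, inner_sum, inner_smul_right,
    Finset.mul_sum]
  rw [← Finset.sum_add_distrib]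
  refine Finset.sum_congr rfl fun j _ => ?_
  ring

/-- `projCoord` is additive. [folklore] -/
lemma projCoord_add (t : κ → V) (r : κ → ℝ) (b b' : V) (ρ ρ' : ℝ) :
    projCoord t r (b + b') (ρ + ρ') = projCoord t r b ρ + projCoord t r b' ρ' := by
  simp only [projCoord, pairVec_add, Matrix.mulVec_add]

/-- `projCoord` is homogeneous. [folklore] -/
lemma projCoord_smul (t : κ → V) (r : κ → ℝ) (c : ℝ) (b : V) (ρ : ℝ) :
    projCoord t r (c • b) (c * ρ) = c • projCoord t r b ρ := by
  simp only [projCoord, pairVec_smul, Matrix.mulVec_smul]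

/-- `projCoord t r 0 0 = 0`. [folklore] -/
lemma projCoord_zero (t : κ → V) (r : κ → ℝ) : projCoord t r 0 0 = 0 := by
  have := projCoord_smul t r 0 0 0
  simpa using this

/-- **Coordinates of an element of `S`**: for invertible Gram matrix,
`projCoord (∑ αⱼ tⱼ) (∑ αⱼ rⱼ) = α`. [folklore] -/
lemma projCoord_combo {t : κ → V} {r : κ → ℝ} (h : IsUnit (gram t r).det) (α : κ → ℝ) :
    projCoord t r (∑ j, α j • t j) (∑ j, α j * r j) = α := by
  rw [projCoord, ← gram_mulVec, Matrix.mulVec_mulVec, Matrix.nonsing_inv_mul _ h, Matrix.one_mulVec]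

/-- **The residual is orthogonal to `S`**: with `β = projCoord b ρ`,
`pairVec (b − ∑ βⱼ tⱼ) (ρ − ∑ βⱼ rⱼ) = 0`. [folklore] -/
lemma pairVec_residual {t : κ → V} {r : κ → ℝ} (h : IsUnit (gram t r).det) (b : V) (ρ : ℝ) :
    pairVec t r (b - ∑ j, projCoord t r b ρ j • t j) (ρ - ∑ j, projCoord t r b ρ j * r j) = 0 := by
  have e : pairVec t r (b - ∑ j, projCoord t r b ρ j • t j) (ρ - ∑ j, projCoord t r b ρ j * r j) =
      pairVec t r b ρ - pairVec t r (∑ j, projCoord t r b ρ j • t j) (∑ j, projCoord t r b ρ j * r j) := by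
    funext k; simp only [pairVec, inner_sub_right, Pi.sub_apply]; ring
  rw [e, ← gram_mulVec, projCoord, Matrix.mulVec_mulVec, Matrix.mul_nonsing_inv _ h, Matrix.one_mulVec,
    sub_self]

omit [DecidableEq κ] in
/-- Pairing a `pairVec` against coefficients: `∑ₖ eₖ pairVec(b, ρ)ₖ = ⟪∑ eₖ tₖ, b⟫ + (∑ eₖ rₖ) ρ`.
[folklore] -/
lemma sum_mul_pairVec (t : κ → V) (r : κ → ℝ) (e : κ → ℝ) (b : V) (ρ : ℝ) :
    ∑ k, e k * pairVec t r b ρ k = ⟪∑ k, e k • t k, b⟫ + (∑ k, e k * r k) * ρ := by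
  simp only [pairVec, mul_add, Finset.sum_add_distrib, sum_inner, real_inner_smul_left, Finset.sum_mul,
    mul_assoc]

/-- The hypothesis `(0, 1) ∈ S = span σ` (the stabilising direction lies in the pushed-forward
stable frame): coefficients `e₀` with `∑ e₀ⱼ tⱼ = 0`, `∑ e₀ⱼ rⱼ = 1`. [folklore] -/
structure UnitVertical (t : κ → V) (r : κ → ℝ) where
  /-- The coordinates of `(0, 1)`. -/
  e₀ : κ → ℝ
  /-- `∑ e₀ⱼ tⱼ = 0`. -/
  sum_smul_t : ∑ j, e₀ j • t j = 0
  /-- `∑ e₀ⱼ rⱼ = 1`. -/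
  sum_mul_r : ∑ j, e₀ j * r j = 1

/-- With `(0,1) ∈ S`, `projCoord 0 1 = e₀`. [folklore] -/
lemma projCoord_zero_one {t : κ → V} {r : κ → ℝ} (h : IsUnit (gram t r).det)
    (hv : UnitVertical t r) : projCoord t r 0 1 = hv.e₀ := by
  have := projCoord_combo h hv.e₀
  rwa [hv.sum_smul_t, hv.sum_mul_r] at this

/-- **The `ℝ`-component of the projection of `(b, 0)` vanishes** when `(0, 1) ∈ S`:
`∑ⱼ projCoord(b,0)ⱼ rⱼ = 0`. [folklore] -/
lemma sum_projCoord_mul_r {t : κ → V} {r : κ → ℝ} (h : IsUnit (gram t r).det)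
    (hv : UnitVertical t r) (b : V) : ∑ j, projCoord t r b 0 j * r j = 0 := by
  have hres := pairVec_residual h b 0
  have key := sum_mul_pairVec t r hv.e₀ (b - ∑ j, projCoord t r b 0 j • t j)
    (0 - ∑ j, projCoord t r b 0 j * r j)
  rw [hres, hv.sum_smul_t, hv.sum_mul_r, inner_zero_left, zero_add, one_mul] at key
  simp only [Pi.zero_apply, mul_zero, Finset.sum_const_zero] at key
  linarith

/-- The `V`-projection `π b = ∑ⱼ projCoord(b,0)ⱼ tⱼ`. [folklore] -/
def proj (t : κ → V) (r : κ → ℝ) (b : V) : V := ∑ j, projCoord t r b 0 j • t j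

/-- `proj` is additive. [folklore] -/
lemma proj_add (t : κ → V) (r : κ → ℝ) (b b' : V) : proj t r (b + b') = proj t r b + proj t r b' := by
  simp only [proj]
  rw [← Finset.sum_add_distrib]
  refine Finset.sum_congr rfl fun j _ => ?_
  have := congrFun (projCoord_add t r b b' 0 0) j
  rw [add_zero] at this
  rw [this, Pi.add_apply, add_smul]

/-- `proj` is homogeneous. [folklore] -/
lemma proj_smul (t : κ → V) (r : κ → ℝ) (c : ℝ) (b : V) : proj t r (c • b) = c • proj t r b := by
  simp only [proj, Finset.smul_sum, smul_smul]
  refine Finset.sum_congr rfl fun j _ => ?_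
  have := congrFun (projCoord_smul t r c b 0) j
  rw [mul_zero] at this
  rw [this, Pi.smul_apply, smul_eq_mul]

/-- `proj` vanishes on `0`. [folklore] -/
lemma proj_zero (t : κ → V) (r : κ → ℝ) : proj t r 0 = 0 := by
  simpa using proj_smul t r 0 0

/-- **The `V`-projection fixes `span t`** (when `(0,1) ∈ S`). [folklore] -/
lemma proj_combo {t : κ → V} {r : κ → ℝ} (h : IsUnit (gram t r).det) (hv : UnitVertical t r)
    (α : κ → ℝ) : proj t r (∑ j, α j • t j) = ∑ j, α j • t j := by
  -- `(∑ αⱼ tⱼ, 0) = Λ (α − (∑ αⱼ rⱼ) e₀)`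
  set ρ := ∑ j, α j * r j with hρ
  have ht : ∑ j, (α j - ρ * hv.e₀ j) • t j = ∑ j, α j • t j := by
    simp only [sub_smul, Finset.sum_sub_distrib, mul_smul, ← Finset.smul_sum, hv.sum_smul_t, smul_zero,
      sub_zero]
  have hr : ∑ j, (α j - ρ * hv.e₀ j) * r j = 0 := by
    simp only [sub_mul, Finset.sum_sub_distrib, mul_assoc, ← Finset.mul_sum, hv.sum_mul_r, mul_one]
    rw [hρ, sub_self]
  have hc := projCoord_combo h (fun j => α j - ρ * hv.e₀ j)
  rw [ht, hr] at hc
  rw [proj, hc, ht]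

/-- `proj` fixes every element of `span t`. [folklore] -/
lemma proj_eq_self_of_mem_span {t : κ → V} {r : κ → ℝ} (h : IsUnit (gram t r).det)
    (hv : UnitVertical t r) {u : V} (hu : u ∈ Submodule.span ℝ (Set.range t)) : proj t r u = u := by
  obtain ⟨α, rfl⟩ := (Submodule.mem_span_range_iff_exists_fun ℝ).1 hu
  exact proj_combo h hv α

/-- `proj b ∈ span t`. [folklore] -/
lemma proj_mem_span (t : κ → V) (r : κ → ℝ) (b : V) : proj t r b ∈ Submodule.span ℝ (Set.range t) :=
  Submodule.sum_mem _ fun j _ => Submodule.smul_mem _ _ (Submodule.subset_span ⟨j, rfl⟩)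

/-- `proj` is idempotent. [folklore] -/
lemma proj_proj {t : κ → V} {r : κ → ℝ} (h : IsUnit (gram t r).det) (hv : UnitVertical t r)
    (b : V) : proj t r (proj t r b) = proj t r b :=
  proj_eq_self_of_mem_span h hv (proj_mem_span t r b)

/-- The coordinates of the residual `b − π b` vanish. [folklore] -/
lemma projCoord_residual {t : κ → V} {r : κ → ℝ} (h : IsUnit (gram t r).det) (hv : UnitVertical t r)
    (b : V) : projCoord t r (b - proj t r b) 0 = 0 := by
  have hres := pairVec_residual h b 0
  rw [sum_projCoord_mul_r h hv b, sub_zero] at hres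
  change pairVec t r (b - proj t r b) 0 = 0 at hres
  rw [projCoord, hres, Matrix.mulVec_zero]

/-! ### Transversality and spanning of the normal frame -/

/-- **Transversality of the stable normal frame** (Kervaire–Milnor 1963, proof of Thm. 3.1: the
frame of `ν ⊕ ε^{d+1} ≅ ε^{A+1}` is complementary to the tangent directions): if
`(u, 0) = normalVec t r b μ` with `u ∈ span t`, then `u = 0`, `b = 0` and `μ = 0`.
[cite: KervaireMilnorAnnals1963, §3 proof of Thm. 3.1] -/
theorem normalVec_transverse {t : κ → V} {r : κ → ℝ} (h : IsUnit (gram t r).det)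
    (hv : UnitVertical t r) {u b : V} {μ : ℝ} (hu : u ∈ Submodule.span ℝ (Set.range t))
    (heq : ((u, 0) : V × (κ → ℝ)) = normalVec t r b μ) : u = 0 ∧ b = 0 ∧ μ = 0 := by
  have h1 : u = b - proj t r b := congrArg Prod.fst heq
  have h2 : (0 : κ → ℝ) = projCoord t r b 0 + μ • projCoord t r 0 1 := congrArg Prod.snd heq
  rw [projCoord_zero_one h hv] at h2
  -- pair the coordinate identity with `r`: `μ = 0`
  have hμ : μ = 0 := by
    have := congrArg (fun γ : κ → ℝ => ∑ j, γ j * r j) h2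
    simp only [Pi.zero_apply, zero_mul, Finset.sum_const_zero, Pi.add_apply, Pi.smul_apply,
      smul_eq_mul, add_mul, Finset.sum_add_distrib, sum_projCoord_mul_r h hv b, zero_add,
      mul_assoc, ← Finset.mul_sum, hv.sum_mul_r, mul_one] at this
    exact this.symm
  rw [hμ, zero_smul, add_zero] at h2
  -- hence `π b = 0`, `u = b ∈ span t`, `b = π b = 0`
  have hπ : proj t r b = 0 := by
    rw [proj, ← h2]; simp
  rw [hπ, sub_zero] at h1
  subst h1
  have hb : proj t r u = u := proj_eq_self_of_mem_span h hv hu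
  rw [hπ] at hb
  exact ⟨hb.symm, hb.symm, hμ⟩

/-- **The normal frame together with the tangent directions spans**: every `(v, c)` is
`(u, 0) + normalVec t r b μ` with `u ∈ span t`. [cite: KervaireMilnorAnnals1963, §3 proof of Thm. 3.1] -/
theorem normalVec_spanning {t : κ → V} {r : κ → ℝ} (h : IsUnit (gram t r).det)
    (hv : UnitVertical t r) (v : V) (c : κ → ℝ) :
    ∃ u ∈ Submodule.span ℝ (Set.range t), ∃ (b : V) (μ : ℝ),
      ((v, c) : V × (κ → ℝ)) = (u, 0) + normalVec t r b μ := by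
  -- `(∑ cⱼ tⱼ, ∑ cⱼ rⱼ) = Λ c`
  set u' : V := ∑ j, c j • t j with hu'
  set ρ' : ℝ := ∑ j, c j * r j with hρ'
  refine ⟨proj t r v, proj_mem_span t r v, (v - proj t r v) + u', ρ', ?_⟩
  have hcoord : projCoord t r u' 0 = c - ρ' • hv.e₀ := by
    have ht : ∑ j, (c j - ρ' * hv.e₀ j) • t j = u' := by
      simp only [sub_smul, Finset.sum_sub_distrib, mul_smul, ← Finset.smul_sum, hv.sum_smul_t,
        smul_zero, sub_zero, hu']
    have hr : ∑ j, (c j - ρ' * hv.e₀ j) * r j = 0 := by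
      simp only [sub_mul, Finset.sum_sub_distrib, mul_assoc, ← Finset.mul_sum, hv.sum_mul_r, mul_one]
      rw [hρ', sub_self]
    have hc := projCoord_combo h (fun j => c j - ρ' * hv.e₀ j)
    rw [ht, hr] at hc
    rw [hc]; funext j; simp [smul_eq_mul]
  have hπu' : proj t r u' = u' := proj_combo h hv c
  have hπn : proj t r (v - proj t r v) = 0 := by
    rw [sub_eq_add_neg, proj_add, ← neg_one_smul ℝ (proj t r v), proj_smul, proj_proj h hv,
      neg_one_smul, add_neg_cancel]
  refine Prod.ext ?_ ?_
  · -- first component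
    change v = proj t r v + ((v - proj t r v + u') - proj t r (v - proj t r v + u'))
    rw [proj_add, hπn, hπu', zero_add]
    abel
  · -- second component
    change c = 0 + (projCoord t r (v - proj t r v + u') 0 + ρ' • projCoord t r 0 1)
    rw [zero_add, show (0 : ℝ) = 0 + 0 from (add_zero 0).symm, projCoord_add,
      projCoord_residual h hv v, zero_add, hcoord, projCoord_zero_one h hv]
    simp

/-! ### The Gram matrix of an independent family is invertible -/

omit [DecidableEq κ] in
/-- The quadratic form of the Gram matrix: `α ⬝ (gram α) = ‖∑ αⱼ tⱼ‖² + (∑ αⱼ rⱼ)²`. [folklore] -/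
lemma dotProduct_gram_mulVec (t : κ → V) (r : κ → ℝ) (α : κ → ℝ) :
    α ⬝ᵥ (gram t r *ᵥ α) = ⟪∑ j, α j • t j, ∑ j, α j • t j⟫ + (∑ j, α j * r j) ^ 2 := by
  rw [gram_mulVec, dotProduct, sum_mul_pairVec, sq]

/-- **The Gram matrix of a linearly independent family `σⱼ = (tⱼ, rⱼ)` is invertible** (the
form `⟪v, v'⟫ + ρρ'` is positive definite). [folklore] -/
theorem isUnit_det_gram {t : κ → V} {r : κ → ℝ}
    (hli : LinearIndependent ℝ fun j => ((t j, r j) : V × ℝ)) : IsUnit (gram t r).det := by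
  -- show the kernel of `gram t r *ᵥ ·` is trivial
  rw [← Matrix.isUnit_iff_isUnit_det, ← Matrix.mulVec_injective_iff_isUnit]
  intro α α' hαα'
  have hsub : gram t r *ᵥ (α - α') = 0 := by rw [Matrix.mulVec_sub, hαα', sub_self]
  set γ := α - α' with hγ
  have hq := dotProduct_gram_mulVec t r γ
  rw [hsub, dotProduct_zero] at hq
  have h1 : ⟪∑ j, γ j • t j, ∑ j, γ j • t j⟫ = 0 := by
    have := real_inner_self_nonneg (x := ∑ j, γ j • t j)
    nlinarith [sq_nonneg (∑ j, γ j * r j)]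
  have h2 : (∑ j, γ j * r j) = 0 := by
    have := real_inner_self_nonneg (x := ∑ j, γ j • t j)
    nlinarith [sq_nonneg (∑ j, γ j * r j)]
  have hzero : ∑ j, γ j • ((t j, r j) : V × ℝ) = 0 := by
    rw [Prod.ext_iff]
    constructor
    · rw [Prod.fst_sum]; simpa using inner_self_eq_zero.1 h1
    · rw [Prod.snd_sum]; simpa [smul_eq_mul] using h2
  have := Fintype.linearIndependent_iff.1 hli γ hzero
  exact sub_eq_zero.1 (funext this)

/-! ### Continuity in the data -/

omit [Fintype κ] [DecidableEq κ] in
/-- The Gram matrix depends continuously on the data. [folklore] -/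
theorem continuous_gram {X : Type*} [TopologicalSpace X] {t : X → κ → V} {r : X → κ → ℝ}
    (ht : ∀ j, Continuous fun x => t x j) (hr : ∀ j, Continuous fun x => r x j) :
    Continuous fun x => gram (t x) (r x) :=
  continuous_matrix fun j k => ((ht j).inner (ht k)).add ((hr j).mul (hr k))

omit [Fintype κ] [DecidableEq κ] in
/-- `pairVec` depends continuously on the data. [folklore] -/
theorem continuous_pairVec {X : Type*} [TopologicalSpace X] {t : X → κ → V} {r : X → κ → ℝ}
    (ht : ∀ j, Continuous fun x => t x j) (hr : ∀ j, Continuous fun x => r x j) (b : V) (ρ : ℝ) :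
    Continuous fun x => pairVec (t x) (r x) b ρ :=
  continuous_pi fun k => ((ht k).inner continuous_const).add ((hr k).mul continuous_const)

/-- **`projCoord` depends continuously on the data** where the Gram matrix is invertible
(`A⁻¹ = (det A)⁻¹ • adj A`). [folklore] -/
theorem continuous_projCoord {X : Type*} [TopologicalSpace X] {t : X → κ → V} {r : X → κ → ℝ}
    (ht : ∀ j, Continuous fun x => t x j) (hr : ∀ j, Continuous fun x => r x j)
    (hdet : ∀ x, (gram (t x) (r x)).det ≠ 0) (b : V) (ρ : ℝ) :
    Continuous fun x => projCoord (t x) (r x) b ρ := by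
  have hinv : Continuous fun x => (gram (t x) (r x))⁻¹ := by
    have e : (fun x => (gram (t x) (r x))⁻¹) =
        fun x => ((gram (t x) (r x)).det)⁻¹ • (gram (t x) (r x)).adjugate := by
      funext x; rw [Matrix.inv_def, Ring.inverse_eq_inv']
    rw [e]
    exact ((continuous_gram ht hr).matrix_det.inv₀ hdet).smul (continuous_gram ht hr).matrix_adjugate
  exact hinv.matrix_mulVec (continuous_pairVec ht hr b ρ)

/-- **The normal frame map depends continuously on the data** where the Gram matrix is
invertible. [folklore] -/
theorem continuous_normalVec {X : Type*} [TopologicalSpace X] {t : X → κ → V} {r : X → κ → ℝ}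
    (ht : ∀ j, Continuous fun x => t x j) (hr : ∀ j, Continuous fun x => r x j)
    (hdet : ∀ x, (gram (t x) (r x)).det ≠ 0) (b : V) (μ : ℝ) :
    Continuous fun x => normalVec (t x) (r x) b μ := by
  refine (continuous_const.sub (continuous_finsetSum _ fun j _ => ?_)).prodMk
    ((continuous_projCoord ht hr hdet b 0).add
      ((continuous_projCoord ht hr hdet 0 1).const_smul μ))
  exact ((continuous_apply j).comp (continuous_projCoord ht hr hdet b 0)).smul (ht j)

end StableNormalFrame

end Literature.Topology.FourManifolds
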